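import Summits.QuantumAdvantage.QuantumAdvantage.Theorems.AnchorDialStep

/-!
# AnchorDial — Equi (cell decomp-qadv, seat lens-2, generation 14 rev 4; supports item 26531 `ExactnessDial.PolyLossOddU3`)

§12b (end) + §12c of the node (rev 4): sign bookkeeping (`sg`, `psgn_eq_sg`, `psgn_eq_bsgn`, `sgn_solve`, …, **`odd_zvec_iff`**: inside a
(prefix-sign, tail-sign) class, «odd ∧ the four site parities = z» is five block-sign conditions), `split_sign`, **`piece_le`**,
**`equi5_of`** (`Equi5 N D' (m+t) (2m+t) (3m+t) (4m+t) 2^(N-45)` for `m` odd `≥ 3`, `5m+t+1 ≤ N`, `2^47·2D'·C(m,m/2) ≤ 2^m`), the degree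
budget `hK_of_sq` (`2^96·D'² ≤ m`), **`equi5Hyp : Equi5Hyp`** (`m = 2(⌊n/12⌋-1)+1`, `η = 2^(n-45)`), the crux
**`movingPointerLoss3 : MovingPointerLoss3` PROVED** (exponent `C = 1`), the node collapse
**`polyLossOddU3_iff_ptrLocLift3 : PolyLossOddU3 ↔ PtrLocLift3`** and `closes_final : PtrLocLift3 → DPLift3 → AdviceFreeQNC0Three`.
Axioms of `movingPointerLoss3` / `closes_final`: `propext`, `Classical.choice`, `Quot.sound`.

Split (≤ 400 lines, part 10/10) of the node file `HOME/decomp-qadv-lens-2/g14/AnchorDial.lean` (rev 4; sha256 in SHA256SUMS.txt, farm rc 0, no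
placeholders); declarations verbatim, namespace `Summit.QuantumAdvantage.QuantumAdvantage.Theorems.AnchorDial`.  Record: NODE-g14.md.
-/

set_option linter.dupNamespace false
set_option linter.unusedVariables false

noncomputable section

open scoped Classical

namespace Summit.QuantumAdvantage.QuantumAdvantage.Theorems.AnchorDial

open Finset
open Literature.Computability.QuantumComplexity Literature.Computability.QuantumComplexity.RingHLF
open Literature.Computability.MetaComplexity Literature.Computability.MetaComplexity.Smolensky
open Summit.QuantumAdvantage.AdviceFreeQNC0
open Summit.QuantumAdvantage.QuantumAdvantage.Theses (ExactnessDial.PolyLossOddU3 ExactnessDial.DPLift3)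

variable {N : ℕ}

section Equi

/-- the sign of a bit: `(-1)^{[b]}`. -/
def sg (b : Bool) : ZMod 3 := if b then -1 else 1

/-- AnchorDialEqui helper `sg_cases` (decomp-qadv land package; see the module docstring). -/
theorem sg_cases (b : Bool) : sg b = 1 ∨ sg b = -1 := by cases b <;> decide

/-- AnchorDialEqui helper `sg_inj` (decomp-qadv land package; see the module docstring). -/
theorem sg_inj {b b' : Bool} (h : sg b = sg b') : b = b' := by
  revert h; cases b <;> cases b' <;> decide

/-- AnchorDialEqui helper `psgn_eq_sg` (decomp-qadv land package; see the module docstring). -/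
theorem psgn_eq_sg (x : Fin N → Bool) (k : ℕ) : psgn x k = sg (zpar x k) := rfl

/-- prefix sign = sign of the initial block. -/
theorem psgn_eq_bsgn (x : Fin N → Bool) (k : ℕ) : psgn x k = bsgn 0 k x := by
  have h := psgn_add x 0 k
  rwa [zero_add, psgn_zero, one_mul] at h

/-- AnchorDialEqui helper `sgn_solve` (decomp-qadv land package; see the module docstring). -/
theorem sgn_solve {a b r : ZMod 3} (h : a = r * b) (hr : r = 1 ∨ r = -1) : b = r * a := by
  rcases hr with rfl | rfl
  · rw [h]; ring
  · rw [h]; ring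

/-- AnchorDialEqui helper `sgn_eval` (decomp-qadv land package; see the module docstring). -/
theorem sgn_eval {a r : ZMod 3} (hr : r = 1 ∨ r = -1) : r * (r * a) = a := by
  rcases hr with rfl | rfl <;> ring

/-- AnchorDialEqui helper `sgn_solve_tail` (decomp-qadv land package; see the module docstring). -/
theorem sgn_solve_tail {a b r : ZMod 3} (h : (-1 : ZMod 3) = a * b * r) (ha : a = 1 ∨ a = -1)
    (hb : b = 1 ∨ b = -1) (hr : r = 1 ∨ r = -1) : b = -(a * r) := by
  rcases ha with rfl | rfl <;> rcases hb with rfl | rfl <;> rcases hr with rfl | rfl <;> revert h <;> decide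

/-- AnchorDialEqui helper `sgn_eval_tail` (decomp-qadv land package; see the module docstring). -/
theorem sgn_eval_tail {a r : ZMod 3} (ha : a = 1 ∨ a = -1) (hr : r = 1 ∨ r = -1) :
    a * -(a * r) * r = -1 := by
  rcases ha with rfl | rfl <;> rcases hr with rfl | rfl <;> decide

/-- **sign bookkeeping**: inside a (prefix-sign, tail-sign) class `(ρ₀, ρ₆)`, «odd ∧ the four site parities are
`(z₁, z₂, z₃, z₄)`» is the conjunction of five block-sign conditions (sites `b_i = i·m + t`, blocks
`[t+1, m+t+1), …, [4m+t+1, 5m+t+1)`). -/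
theorem odd_zvec_iff {m t : ℕ} (h6 : 5 * m + t + 1 ≤ N) (x : Fin N → Bool) {ρ₀ ρ₆ : ZMod 3}
    (hρ₀ : ρ₀ = 1 ∨ ρ₀ = -1) (hρ₆ : ρ₆ = 1 ∨ ρ₆ = -1)
    (hc0 : bsgn 0 (t + 1) x = ρ₀) (hc6 : bsgn (5 * m + t + 1) (N - (5 * m + t + 1)) x = ρ₆) (z1 z2 z3 z4 : Bool) :
    (OddZeros x ∧ zvec (m + t) (2 * m + t) (3 * m + t) (4 * m + t) x = (z1, z2, z3, z4)) ↔
    ((((bsgn (t + 1) m x = ρ₀ * sg z1 ∧ bsgn (m + t + 1) m x = sg z1 * sg z2) ∧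
      bsgn (2 * m + t + 1) m x = sg z2 * sg z3) ∧ bsgn (3 * m + t + 1) m x = sg z3 * sg z4) ∧
      bsgn (4 * m + t + 1) m x = -(sg z4 * ρ₆)) := by
  have P0 : psgn x (t + 1) = ρ₀ := by rw [psgn_eq_bsgn, hc0]
  have P1 : psgn x (m + t + 1) = psgn x (t + 1) * bsgn (t + 1) m x := by
    rw [show m + t + 1 = t + 1 + m by ring]; exact psgn_add x (t + 1) m
  have P2 : psgn x (2 * m + t + 1) = psgn x (m + t + 1) * bsgn (m + t + 1) m x := by
    rw [show 2 * m + t + 1 = m + t + 1 + m by ring]; exact psgn_add x (m + t + 1) m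
  have P3 : psgn x (3 * m + t + 1) = psgn x (2 * m + t + 1) * bsgn (2 * m + t + 1) m x := by
    rw [show 3 * m + t + 1 = 2 * m + t + 1 + m by ring]; exact psgn_add x (2 * m + t + 1) m
  have P4 : psgn x (4 * m + t + 1) = psgn x (3 * m + t + 1) * bsgn (3 * m + t + 1) m x := by
    rw [show 4 * m + t + 1 = 3 * m + t + 1 + m by ring]; exact psgn_add x (3 * m + t + 1) m
  have P5 : psgn x (5 * m + t + 1) = psgn x (4 * m + t + 1) * bsgn (4 * m + t + 1) m x := by
    rw [show 5 * m + t + 1 = 4 * m + t + 1 + m by ring]; exact psgn_add x (4 * m + t + 1) m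
  have PN : psgn x N = psgn x (5 * m + t + 1) * bsgn (5 * m + t + 1) (N - (5 * m + t + 1)) x := by
    have h := psgn_add x (5 * m + t + 1) (N - (5 * m + t + 1))
    rwa [show 5 * m + t + 1 + (N - (5 * m + t + 1)) = N by omega] at h
  rw [P0] at P1
  rw [hc6] at PN
  constructor
  · rintro ⟨hodd, hz⟩
    simp only [zvec, Prod.mk.injEq] at hz
    obtain ⟨hz1, hz2, hz3, hz4⟩ := hz
    have v1 : psgn x (m + t + 1) = sg z1 := by rw [psgn_eq_sg, hz1]
    have v2 : psgn x (2 * m + t + 1) = sg z2 := by rw [psgn_eq_sg, hz2]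
    have v3 : psgn x (3 * m + t + 1) = sg z3 := by rw [psgn_eq_sg, hz3]
    have v4 : psgn x (4 * m + t + 1) = sg z4 := by rw [psgn_eq_sg, hz4]
    have vN : psgn x N = -1 := (oddZeros_iff_psgn x).1 hodd
    rw [v1] at P1 P2
    rw [v2] at P2 P3
    rw [v3] at P3 P4
    rw [v4] at P4 P5
    rw [vN, P5] at PN
    refine ⟨⟨⟨⟨sgn_solve P1 hρ₀, sgn_solve P2 (sg_cases z1)⟩, sgn_solve P3 (sg_cases z2)⟩,
      sgn_solve P4 (sg_cases z3)⟩, ?_⟩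
    exact sgn_solve_tail PN (sg_cases z4) (bsgn_cases _ _ x) hρ₆
  · rintro ⟨⟨⟨⟨b0, b1⟩, b2⟩, b3⟩, b4⟩
    have v1 : psgn x (m + t + 1) = sg z1 := by rw [P1, b0]; exact sgn_eval hρ₀
    have v2 : psgn x (2 * m + t + 1) = sg z2 := by rw [P2, v1, b1]; exact sgn_eval (sg_cases z1)
    have v3 : psgn x (3 * m + t + 1) = sg z3 := by rw [P3, v2, b2]; exact sgn_eval (sg_cases z2)
    have v4 : psgn x (4 * m + t + 1) = sg z4 := by rw [P4, v3, b3]; exact sgn_eval (sg_cases z3)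
    have vN : psgn x N = -1 := by rw [PN, P5, v4, b4]; exact sgn_eval_tail (sg_cases z4) hρ₆
    refine ⟨(oddZeros_iff_psgn x).2 vN, ?_⟩
    rw [psgn_eq_sg] at v1 v2 v3 v4
    simp only [zvec, Prod.mk.injEq]
    exact ⟨sg_inj v1, sg_inj v2, sg_inj v3, sg_inj v4⟩

/-- splitting a count by a block sign. -/
theorem split_sign (Q : (Fin N → Bool) → Prop) [DecidablePred Q] (s' m' : ℕ) :
    (univ.filter fun x => Q x).card =
      (univ.filter fun x => Q x ∧ bsgn s' m' x = 1).card + (univ.filter fun x => Q x ∧ bsgn s' m' x = -1).card := by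
  rw [← Finset.card_union_of_disjoint (Finset.disjoint_filter.2 fun x _ h1 h2 => by
    rw [h1.2] at h2; exact absurd h2.2 (by decide))]
  congr 1
  ext x
  simp only [mem_union, mem_filter, mem_univ, true_and]
  constructor
  · intro h
    rcases bsgn_cases s' m' x with e | e
    · exact Or.inl ⟨h, e⟩
    · exact Or.inr ⟨h, e⟩
  · rintro (h | h) <;> exact h.1

/-- one (prefix, tail) class: the chain bound for the piece of `{odd ∧ E = 1 ∧ zvec = z}` in the class. -/
theorem piece_le {m t D' : ℕ} (hm : Odd m) (hm3 : 3 ≤ m) (h6 : 5 * m + t + 1 ≤ N)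
    (hK : 140737488355328 * ((D' + D') * m.choose (m / 2)) ≤ 2 ^ m)
    {E : CubeFn (ZMod 3) N} (hE : E ∈ lowDeg (ZMod 3) N D') (z1 z2 z3 z4 : Bool)
    (ρ₀ ρ₆ : ZMod 3) (hρ₀ : ρ₀ = 1 ∨ ρ₀ = -1) (hρ₆ : ρ₆ = 1 ∨ ρ₆ = -1) :
    140737488355328 * (32 * (univ.filter fun x : Fin N → Bool =>
        ((OddZeros x ∧ E x = 1 ∧ zvec (m + t) (2 * m + t) (3 * m + t) (4 * m + t) x = (z1, z2, z3, z4)) ∧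
          bsgn 0 (t + 1) x = ρ₀) ∧ bsgn (5 * m + t + 1) (N - (5 * m + t + 1)) x = ρ₆).card) ≤
      140737488355328 * (univ.filter fun x : Fin N → Bool =>
        (E x = 1 ∧ bsgn 0 (t + 1) x = ρ₀) ∧ bsgn (5 * m + t + 1) (N - (5 * m + t + 1)) x = ρ₆).card +
        31 * 2 ^ N := by
  have hτ0 : ρ₀ * sg z1 = 1 ∨ ρ₀ * sg z1 = -1 := by
    rcases hρ₀ with rfl | rfl <;> rcases sg_cases z1 with h | h <;> rw [h] <;> decide
  have hτ : ∀ b b' : Bool, sg b * sg b' = 1 ∨ sg b * sg b' = -1 := by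
    intro b b'; cases b <;> cases b' <;> decide
  have hτ4 : -(sg z4 * ρ₆) = 1 ∨ -(sg z4 * ρ₆) = -1 := by
    rcases hρ₆ with rfl | rfl <;> rcases sg_cases z4 with h | h <;> rw [h] <;> decide
  have hc := chain5 (N := N) (s0 := t + 1) (s1 := m + t + 1) (s2 := 2 * m + t + 1) (s3 := 3 * m + t + 1)
    (s4 := 4 * m + t + 1) (m := m) (by omega) (by omega) (by omega) (by omega) (by omega) hm hm3 hK hE
    (fun x => bsgn 0 (t + 1) x = ρ₀ ∧ bsgn (5 * m + t + 1) (N - (5 * m + t + 1)) x = ρ₆)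
    (fun ρ w w' h => by
      rw [bsgn_joinAt_of_disjoint (s := t + 1) (m := m) (s' := 0) (m' := t + 1) (Or.inl (by omega)),
        bsgn_joinAt_of_disjoint (s := t + 1) (m := m) (s' := 5 * m + t + 1) (m' := N - (5 * m + t + 1))
          (Or.inr (by omega))] at h ⊢
      exact h)
    (fun ρ w w' h => by
      rw [bsgn_joinAt_of_disjoint (s := m + t + 1) (m := m) (s' := 0) (m' := t + 1) (Or.inl (by omega)),
        bsgn_joinAt_of_disjoint (s := m + t + 1) (m := m) (s' := 5 * m + t + 1) (m' := N - (5 * m + t + 1))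
          (Or.inr (by omega))] at h ⊢
      exact h)
    (fun ρ w w' h => by
      rw [bsgn_joinAt_of_disjoint (s := 2 * m + t + 1) (m := m) (s' := 0) (m' := t + 1) (Or.inl (by omega)),
        bsgn_joinAt_of_disjoint (s := 2 * m + t + 1) (m := m) (s' := 5 * m + t + 1) (m' := N - (5 * m + t + 1))
          (Or.inr (by omega))] at h ⊢
      exact h)
    (fun ρ w w' h => by
      rw [bsgn_joinAt_of_disjoint (s := 3 * m + t + 1) (m := m) (s' := 0) (m' := t + 1) (Or.inl (by omega)),
        bsgn_joinAt_of_disjoint (s := 3 * m + t + 1) (m := m) (s' := 5 * m + t + 1) (m' := N - (5 * m + t + 1))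
          (Or.inr (by omega))] at h ⊢
      exact h)
    (fun ρ w w' h => by
      rw [bsgn_joinAt_of_disjoint (s := 4 * m + t + 1) (m := m) (s' := 0) (m' := t + 1) (Or.inl (by omega)),
        bsgn_joinAt_of_disjoint (s := 4 * m + t + 1) (m := m) (s' := 5 * m + t + 1) (m' := N - (5 * m + t + 1))
          (Or.inr (by omega))] at h ⊢
      exact h)
    (ρ₀ * sg z1) (sg z1 * sg z2) (sg z2 * sg z3) (sg z3 * sg z4) (-(sg z4 * ρ₆)) hτ0 (hτ z1 z2) (hτ z2 z3)
    (hτ z3 z4) hτ4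
  have e1 : (univ.filter fun x : Fin N → Bool =>
        ((OddZeros x ∧ E x = 1 ∧ zvec (m + t) (2 * m + t) (3 * m + t) (4 * m + t) x = (z1, z2, z3, z4)) ∧
          bsgn 0 (t + 1) x = ρ₀) ∧ bsgn (5 * m + t + 1) (N - (5 * m + t + 1)) x = ρ₆) =
      univ.filter fun x : Fin N → Bool => E x = 1 ∧ (((((bsgn 0 (t + 1) x = ρ₀ ∧
        bsgn (5 * m + t + 1) (N - (5 * m + t + 1)) x = ρ₆) ∧ bsgn (t + 1) m x = ρ₀ * sg z1) ∧
        bsgn (m + t + 1) m x = sg z1 * sg z2) ∧ bsgn (2 * m + t + 1) m x = sg z2 * sg z3) ∧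
        bsgn (3 * m + t + 1) m x = sg z3 * sg z4) ∧ bsgn (4 * m + t + 1) m x = -(sg z4 * ρ₆) := by
    refine filter_congr fun x _ => ?_
    constructor
    · rintro ⟨⟨⟨hodd, hE1, hz⟩, hc0⟩, hc6⟩
      obtain ⟨⟨⟨⟨b0, b1⟩, b2⟩, b3⟩, b4⟩ := (odd_zvec_iff h6 x hρ₀ hρ₆ hc0 hc6 z1 z2 z3 z4).1 ⟨hodd, hz⟩
      exact ⟨hE1, ⟨⟨⟨⟨⟨hc0, hc6⟩, b0⟩, b1⟩, b2⟩, b3⟩, b4⟩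
    · rintro ⟨hE1, ⟨⟨⟨⟨⟨hc0, hc6⟩, b0⟩, b1⟩, b2⟩, b3⟩, b4⟩
      obtain ⟨hodd, hz⟩ := (odd_zvec_iff h6 x hρ₀ hρ₆ hc0 hc6 z1 z2 z3 z4).2 ⟨⟨⟨⟨b0, b1⟩, b2⟩, b3⟩, b4⟩
      exact ⟨⟨⟨hodd, hE1, hz⟩, hc0⟩, hc6⟩
  have e2 : (univ.filter fun x : Fin N → Bool =>
        (E x = 1 ∧ bsgn 0 (t + 1) x = ρ₀) ∧ bsgn (5 * m + t + 1) (N - (5 * m + t + 1)) x = ρ₆) =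
      univ.filter fun x : Fin N → Bool =>
        E x = 1 ∧ (bsgn 0 (t + 1) x = ρ₀ ∧ bsgn (5 * m + t + 1) (N - (5 * m + t + 1)) x = ρ₆) :=
    filter_congr fun x _ => and_assoc
  rw [e1, e2]
  exact hc

/-- **`Equi5` at admissible sites** (`m` odd, `t < m`, `5m + t + 1 ≤ N`, degree budget `2^47·2D'·C(m,m/2) ≤ 2^m`):
each value of the four site parities takes at most `1/32` of `{E = 1}` among odd inputs, up to `2^(N-45)`. -/
theorem equi5_of {m t D' : ℕ} (hm : Odd m) (hm3 : 3 ≤ m) (h6 : 5 * m + t + 1 ≤ N) (hN : 47 ≤ N)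
    (hK : 140737488355328 * ((D' + D') * m.choose (m / 2)) ≤ 2 ^ m) :
    Equi5 N D' (m + t) (2 * m + t) (3 * m + t) (4 * m + t) (2 ^ (N - 45)) := by
  intro E hE z
  obtain ⟨z1, z2, z3, z4⟩ := z
  -- the four pieces / classes
  have p11 := piece_le hm hm3 h6 hK hE z1 z2 z3 z4 1 1 (Or.inl rfl) (Or.inl rfl)
  have p1m := piece_le hm hm3 h6 hK hE z1 z2 z3 z4 1 (-1) (Or.inl rfl) (Or.inr rfl)
  have pm1 := piece_le hm hm3 h6 hK hE z1 z2 z3 z4 (-1) 1 (Or.inr rfl) (Or.inl rfl)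
  have pmm := piece_le hm hm3 h6 hK hE z1 z2 z3 z4 (-1) (-1) (Or.inr rfl) (Or.inr rfl)
  -- class sums
  have hS := split_sign (N := N)
    (fun x => OddZeros x ∧ E x = 1 ∧ zvec (m + t) (2 * m + t) (3 * m + t) (4 * m + t) x = (z1, z2, z3, z4))
    0 (t + 1)
  have hS1 := split_sign (N := N)
    (fun x => (OddZeros x ∧ E x = 1 ∧ zvec (m + t) (2 * m + t) (3 * m + t) (4 * m + t) x = (z1, z2, z3, z4)) ∧
      bsgn 0 (t + 1) x = 1) (5 * m + t + 1) (N - (5 * m + t + 1))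
  have hSm := split_sign (N := N)
    (fun x => (OddZeros x ∧ E x = 1 ∧ zvec (m + t) (2 * m + t) (3 * m + t) (4 * m + t) x = (z1, z2, z3, z4)) ∧
      bsgn 0 (t + 1) x = -1) (5 * m + t + 1) (N - (5 * m + t + 1))
  have hY := split_sign (N := N) (fun x => E x = 1) 0 (t + 1)
  have hY1 := split_sign (N := N) (fun x => E x = 1 ∧ bsgn 0 (t + 1) x = 1) (5 * m + t + 1) (N - (5 * m + t + 1))
  have hYm := split_sign (N := N) (fun x => E x = 1 ∧ bsgn 0 (t + 1) x = -1) (5 * m + t + 1) (N - (5 * m + t + 1))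
  -- the error budget: `124·2^N ≤ K·32·2^(N-45)`
  have hpow : 2 ^ N = 35184372088832 * 2 ^ (N - 45) := by
    rw [show (35184372088832 : ℕ) = 2 ^ 45 by norm_num, ← pow_add]; congr 1; omega
  have herr : 124 * 2 ^ N ≤ 140737488355328 * (32 * 2 ^ (N - 45)) := by rw [hpow]; omega
  have main : ∀ (S S1 Sm P11 P1m Pm1 Pmm Y Y1 Ym Y11 Y1m Ym1 Ymm X e : ℕ),
      S = S1 + Sm → S1 = P11 + P1m → Sm = Pm1 + Pmm → Y = Y1 + Ym → Y1 = Y11 + Y1m → Ym = Ym1 + Ymm →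
      140737488355328 * (32 * P11) ≤ 140737488355328 * Y11 + 31 * X →
      140737488355328 * (32 * P1m) ≤ 140737488355328 * Y1m + 31 * X →
      140737488355328 * (32 * Pm1) ≤ 140737488355328 * Ym1 + 31 * X →
      140737488355328 * (32 * Pmm) ≤ 140737488355328 * Ymm + 31 * X →
      124 * X ≤ 140737488355328 * (32 * e) →
      140737488355328 * (32 * S) ≤ 140737488355328 * (Y + 32 * e) := by
    intros; omega
  exact Nat.le_of_mul_le_mul_left
    (main _ _ _ _ _ _ _ _ _ _ _ _ _ _ _ _ hS hS1 hSm hY hY1 hYm p11 p1m pm1 pmm herr) (by norm_num)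


end Equi

/-! ### §12c asymptotics: `Equi5Hyp`, the crux, and the node collapse -/

section Final

/-- the degree budget from the central binomial bound: `2^96·D'² ≤ m` gives `2^47·2D'·C(m,m/2) ≤ 2^m`. -/
theorem hK_of_sq {m D' : ℕ} (hm : Odd m) (hD : 79228162514264337593543950336 * D' ^ 2 ≤ m) :
    140737488355328 * ((D' + D') * m.choose (m / 2)) ≤ 2 ^ m := by
  have hc := choose_half_sq_mul_le hm
  have h4 : (2 ^ m) * (2 ^ m) = 4 ^ m := by rw [← pow_two, ← pow_mul, mul_comm, pow_mul]; norm_num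
  have key : (140737488355328 * ((D' + D') * m.choose (m / 2))) * (140737488355328 * ((D' + D') * m.choose (m / 2)))
      ≤ (2 ^ m) * (2 ^ m) := by
    calc (140737488355328 * ((D' + D') * m.choose (m / 2))) * (140737488355328 * ((D' + D') * m.choose (m / 2)))
        = (79228162514264337593543950336 * D' ^ 2) * (m.choose (m / 2)) ^ 2 := by ring
      _ ≤ m * (m.choose (m / 2)) ^ 2 := Nat.mul_le_mul_right _ hD
      _ = (m.choose (m / 2)) ^ 2 * m := by ring
      _ ≤ 4 ^ m := hc
      _ = (2 ^ m) * (2 ^ m) := h4.symm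
  exact Nat.mul_self_le_mul_self_iff.1 key

/-- **(E2) PROVED**: admissible spacings with five-block equidistribution exist for all large `n`
(`m = 2(⌊n/12⌋ - 1) + 1`, `η = 2^(n-45)`). -/
theorem equi5Hyp : Equi5Hyp := by
  intro c
  obtain ⟨n₁, hn₁⟩ := TubePlanProof.logPow_le_natSqrt (2 * c + 114)
  refine ⟨max n₁ 19212, fun n hn => ?_⟩
  have hn1 : n₁ ≤ n := le_trans (le_max_left _ _) hn
  have hbig : 19212 ≤ n := le_trans (le_max_right _ _) hn
  have hL : 2 ≤ Nat.log 2 n := Nat.le_log_of_pow_le (by norm_num) (le_trans (by norm_num) hbig)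
  have hs := hn₁ n hn1
  have hsq : Nat.sqrt n * Nat.sqrt n ≤ n := Nat.sqrt_le n
  have h18 : 18 ≤ Nat.sqrt n := by rw [Nat.le_sqrt]; omega
  have h18s : 18 * Nat.sqrt n ≤ n := le_trans (Nat.mul_le_mul_right _ h18) hsq
  set L := Nat.log 2 n with hLdef
  set m := 2 * (n / 12 - 1) + 1 with hmdef
  have hm : Odd m := ⟨n / 12 - 1, rfl⟩
  have hpow : 6 * (79228162514264337593543950336 * (148 * L ^ c) ^ 2) ≤ L ^ (2 * c + 114) := by
    calc 6 * (79228162514264337593543950336 * (148 * L ^ c) ^ 2)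
        = 10412482030274676303893920128958464 * (L ^ c) ^ 2 := by ring
      _ ≤ 2 ^ 114 * (L ^ c) ^ 2 := Nat.mul_le_mul_right _ (by norm_num)
      _ ≤ L ^ 114 * (L ^ c) ^ 2 := Nat.mul_le_mul_right _ (Nat.pow_le_pow_left hL 114)
      _ = L ^ (2 * c + 114) := by ring
  have hD : 79228162514264337593543950336 * (148 * L ^ c) ^ 2 ≤ m := by omega
  refine ⟨m, 2 ^ (n - 45), by omega, by omega, by omega, ?_, fun t ht => ?_⟩
  · rw [show 2 ^ (n - 1) = 17592186044416 * 2 ^ (n - 45) by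
      rw [show (17592186044416 : ℕ) = 2 ^ 44 by norm_num, ← pow_add]; congr 1; omega]
    omega
  · exact equi5_of hm (by omega) (by omega) (by omega) (hK_of_sq hm hD)

/-- **the crux `MovingPointerLoss3` PROVED** (exponent `C = 1`; constant loss `≥ 2^{n-1}/47`): no polylog-degree
certificate `(A, f)` — anchor indicators unique on all but `2^{-12}` of the odd class and stable under all but an
average `2^{-12}` of adjacent pair-flips — points at a good position on more than a `1 - 1/n` fraction of the odd
class. -/
theorem movingPointerLoss3 : MovingPointerLoss3 := movingPointerLoss3_of_equi5Hyp equi5Hyp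

/-- **node collapse**: with the crux proved the node equation reads `T ⟺ PtrLocLift3` — every level of the
dial below «locate the pointer» is a theorem. -/
theorem polyLossOddU3_iff_ptrLocLift3 : ExactnessDial.PolyLossOddU3 ↔ PtrLocLift3 :=
  ⟨fun h _ => h, fun h => h movingPointerLoss3⟩

/-- the dial from the residual alone: `PtrLocLift3 → DPLift3 → AdviceFreeQNC0Three`. -/
theorem closes_final (hL : PtrLocLift3) (hD : ExactnessDial.DPLift3) : AdviceFreeQNC0Three :=
  closes movingPointerLoss3 hL hD

end Final

end Summit.QuantumAdvantage.QuantumAdvantage.Theorems.AnchorDial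

end
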